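import Mathlib.LinearAlgebra.Lagrange
import HarnessLib

/-!
# HANDOFF — the PARTIAL-FRACTION (Lagrange) identity behind the dodger's transform (rh-explicit, track «HANDOFF», seat prove-2 gen8, ATTEMPT-16 Lemma A1 (ii)–(iv))

HONEST FRAMING. Nothing here bears on the truth of RH; this is finite algebra over a field. In ATTEMPT-16
(HOME/handoff/prove-2/ATTEMPT-16.md) the dodger is the cut-off cosine polynomial with coefficients
`a_k = (−1)^{k+1}P(ℓ_k²)/(2Λ^{(k)}(ℓ_k²))`, `P(u) = Π_j(1 − u/z_j²)` the polynomial killing the first `K` zeros, `ℓ_k` the lattice,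
`Λ^{(k)}(u) = Π_{m≠k}(1 − u/ℓ_m²)`; Lemma A1 says its transform is `(sin bξ/(bξ))·P(ξ²)/Λ_K(ξ²)`. Given the kernel computation of the
transform of a cut-off cosine polynomial (`HandoffDodgerTransform.weilMellin_cutoffCosPoly`:
`(sin bξ/(bξ))·[1 + 2Σ(−1)^k a_kξ²/(ξ² − ℓ_k²)]`), what remains is the rational identity
  `P(u)/Π_k(1 − u/ν_k) = 1 − Σ_k [P(ν_k)/Π_{m≠k}(1 − ν_k/ν_m)]·u/(u − ν_k)`   (`u ∉ {ν_k}`)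
for any polynomial `P` with `P(0) = 1`, `deg P ≤ K` and distinct non-zero nodes `ν_k` — Lagrange interpolation of
`P − c_∞Λ_K` at the nodes, equivalently: the two sides are polynomials of degree `≤ K` (after clearing `Λ_K`) agreeing at the
`K+1` points `0, ν_1, …, ν_K`. THIS FILE proves it (`eval_div_prod_eq_one_sub_sum`), via Mathlib's
`Polynomial.eq_of_degree_sub_lt_of_eval_finset_eq`. With `ν_k = ℓ_k²` and `a_k` as above it is exactly A1 (ii)–(iv) (the
edge identity `c_∞ = 1 + 2Σ(−1)^k a_k` of ATTEMPT-15/16 is its value at `u → ∞`, whose `u = 0` form is gen7's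
`sum_prod_oneSubDiv_div_lagrange_zero`). No `sorry`, standard axioms.

References: this track (ATTEMPT-16 §2). Folklore (Lagrange interpolation).
-/

set_option linter.dupNamespace false

open Polynomial Finset

namespace Summit.RiemannHypothesis.RiemannHypothesis.Theorems.Handoff

variable {𝕜 : Type*} [Field 𝕜] {K : ℕ}

/-- The node polynomial `Λ(X) = Π_k (1 − X/ν_k)`. [folklore] -/
noncomputable def nodePoly (ν : Fin K → 𝕜) : 𝕜[X] := ∏ k, (C 1 - C (ν k)⁻¹ * X)

/-- The node polynomial with the `k`-th factor removed, `Λ^{(k)}(X) = Π_{m ≠ k}(1 − X/ν_m)`. [folklore] -/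
noncomputable def nodePolyErase (ν : Fin K → 𝕜) (k : Fin K) : 𝕜[X] := ∏ m ∈ univ.erase k, (C 1 - C (ν m)⁻¹ * X)

/-- Each factor `1 − X/ν` has `natDegree ≤ 1`. [folklore] -/
theorem natDegree_linFactor_le (c : 𝕜) : (C (1 : 𝕜) - C c * X).natDegree ≤ 1 := by
  refine (natDegree_sub_le _ _).trans (max_le ?_ ?_)
  · rw [natDegree_C]; exact zero_le_one
  · exact (natDegree_C_mul_le _ _).trans natDegree_X_le

/-- `deg Λ ≤ K`. [folklore] -/
theorem natDegree_nodePoly_le (ν : Fin K → 𝕜) : (nodePoly ν).natDegree ≤ K := by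
  unfold nodePoly
  have h1 := natDegree_prod_le (Finset.univ : Finset (Fin K)) (fun k ↦ (C (1 : 𝕜) - C (ν k)⁻¹ * X))
  have h2 : ∑ k : Fin K, (C (1 : 𝕜) - C (ν k)⁻¹ * X).natDegree ≤ ∑ _k : Fin K, (1 : ℕ) :=
    Finset.sum_le_sum fun k _ ↦ natDegree_linFactor_le (ν k)⁻¹
  have h3 : ∑ _k : Fin K, (1 : ℕ) = K := by simp
  omega

/-- `deg Λ^{(k)} ≤ K − 1`. [folklore] -/
theorem natDegree_nodePolyErase_le (ν : Fin K → 𝕜) (k : Fin K) : (nodePolyErase ν k).natDegree ≤ K - 1 := by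
  unfold nodePolyErase
  have h1 := natDegree_prod_le (univ.erase k) (fun m ↦ (C (1 : 𝕜) - C (ν m)⁻¹ * X))
  have h2 : ∑ m ∈ univ.erase k, (C (1 : 𝕜) - C (ν m)⁻¹ * X).natDegree ≤ ∑ _m ∈ univ.erase k, (1 : ℕ) :=
    Finset.sum_le_sum fun m _ ↦ natDegree_linFactor_le (ν m)⁻¹
  have h3 : ∑ _m ∈ univ.erase k, (1 : ℕ) = K - 1 := by
    simp [Finset.card_erase_of_mem (mem_univ k)]
  omega

/-- `Λ(u) = Π_k (1 − u/ν_k)`. [folklore] -/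
theorem eval_nodePoly (ν : Fin K → 𝕜) (u : 𝕜) : (nodePoly ν).eval u = ∏ k, (1 - u / ν k) := by
  unfold nodePoly
  rw [eval_prod]
  refine Finset.prod_congr rfl fun k _ ↦ ?_
  simp only [eval_sub, eval_mul, eval_C, eval_X]
  rw [div_eq_mul_inv, mul_comm]

/-- `Λ^{(k)}(u) = Π_{m≠k} (1 − u/ν_m)`. [folklore] -/
theorem eval_nodePolyErase (ν : Fin K → 𝕜) (k : Fin K) (u : 𝕜) :
    (nodePolyErase ν k).eval u = ∏ m ∈ univ.erase k, (1 - u / ν m) := by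
  unfold nodePolyErase
  rw [eval_prod]
  refine Finset.prod_congr rfl fun m _ ↦ ?_
  simp only [eval_sub, eval_mul, eval_C, eval_X]
  rw [div_eq_mul_inv, mul_comm]

/-- `Λ = (1 − X/ν_k)·Λ^{(k)}`. [folklore] -/
theorem nodePoly_eq_mul (ν : Fin K → 𝕜) (k : Fin K) :
    nodePoly ν = (C 1 - C (ν k)⁻¹ * X) * nodePolyErase ν k := by
  unfold nodePoly nodePolyErase
  rw [← Finset.mul_prod_erase _ _ (mem_univ k)]

/-- **The polynomial identity**: for `P(0) = 1`, `deg P ≤ K`, distinct non-zero nodes,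
`P = Λ + Σ_k (P(ν_k)/(ν_k·Λ^{(k)}(ν_k)))·X·Λ^{(k)}` — both sides have degree `≤ K` and agree at `0` and at every node.
[folklore] -/
theorem eq_nodePoly_add_sum (ν : Fin K → 𝕜) (hν : Function.Injective ν) (hν0 : ∀ k, ν k ≠ 0)
    (P : 𝕜[X]) (hP0 : P.eval 0 = 1) (hdeg : P.natDegree ≤ K) :
    P = nodePoly ν + ∑ k, C (P.eval (ν k) / (ν k * (nodePolyErase ν k).eval (ν k))) * X * nodePolyErase ν k := by
  classical
  -- the interpolation set {0} ∪ {ν_k}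
  set s : Finset 𝕜 := insert 0 (univ.image ν) with hs
  have hcard : #s = K + 1 := by
    rw [hs, card_insert_of_notMem, card_image_of_injective _ hν, card_univ, Fintype.card_fin]
    simp only [mem_image, mem_univ, true_and, not_exists]
    exact fun k h ↦ hν0 k h
  -- Λ^{(k)}(ν_k) ≠ 0
  have hLk : ∀ k, (nodePolyErase ν k).eval (ν k) ≠ 0 := by
    intro k
    rw [eval_nodePolyErase, Finset.prod_ne_zero_iff]
    intro m hm
    have hmk : m ≠ k := ne_of_mem_erase hm
    have : ν k / ν m ≠ 1 := by
      intro h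
      rw [div_eq_one_iff_eq (hν0 m)] at h
      exact hmk (hν h).symm
    exact sub_ne_zero.2 (Ne.symm this)
  apply eq_of_degree_sub_lt_of_eval_finset_eq (s := s)
  · -- degree
    rw [hcard]
    have hnat : (P - (nodePoly ν + ∑ k, C (P.eval (ν k) / (ν k * (nodePolyErase ν k).eval (ν k))) * X *
        nodePolyErase ν k)).natDegree ≤ K := by
      refine (natDegree_sub_le _ _).trans (max_le hdeg ?_)
      refine (natDegree_add_le _ _).trans (max_le (natDegree_nodePoly_le ν) ?_)
      refine natDegree_sum_le_of_forall_le _ _ fun k _ ↦ ?_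
      refine natDegree_mul_le.trans ?_
      have h1 : (C (P.eval (ν k) / (ν k * (nodePolyErase ν k).eval (ν k))) * X).natDegree ≤ 1 :=
        natDegree_mul_le.trans (by simp)
      have h2 := natDegree_nodePolyErase_le ν k
      have hK : 1 ≤ K := Nat.succ_le_of_lt (Fin.pos k)
      omega
    exact lt_of_le_of_lt (degree_le_of_natDegree_le hnat) (by exact_mod_cast Nat.lt_succ_self K)
  · -- evaluations
    intro x hx
    rw [hs, mem_insert, mem_image] at hx
    rw [eval_add, eval_finsetSum]
    rcases hx with rfl | ⟨j, -, rfl⟩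
    · -- at 0
      rw [hP0, eval_nodePoly]
      simp
    · -- at the node ν_j
      have hΛ : (nodePoly ν).eval (ν j) = 0 := by
        rw [nodePoly_eq_mul ν j, eval_mul]
        simp [hν0 j]
      rw [hΛ, zero_add, Finset.sum_eq_single j]
      · simp only [eval_mul, eval_C, eval_X]
        have hνj : ν j ≠ 0 := hν0 j
        have hLj := hLk j
        field_simp
      · intro k _ hkj
        have : (nodePolyErase ν k).eval (ν j) = 0 := by
          rw [eval_nodePolyErase, Finset.prod_eq_zero_iff]
          exact ⟨j, mem_erase.2 ⟨Ne.symm hkj, mem_univ j⟩, by simp [hν0 j]⟩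
        simp [this]
      · simp

/-- **The partial-fraction (Lagrange) identity of ATTEMPT-16 Lemma A1 (ii)–(iv)**: for a polynomial `P` with `P(0) = 1` and
`deg P ≤ K`, distinct non-zero nodes `ν_k`, and `u` off the nodes,
`P(u)/Π_k(1 − u/ν_k) = 1 − Σ_k [P(ν_k)/Π_{m≠k}(1 − ν_k/ν_m)]·u/(u − ν_k)`.
With `ν_k = ℓ_k²`, `P(u) = Π_j(1 − u/z_j²)` and `a_k := (−1)^{k+1}P(ℓ_k²)/(2Π_{m≠k}(1 − ℓ_k²/ℓ_m²))` the right side is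
`1 + 2Σ_k(−1)^k a_k u/(u − ℓ_k²)`, the bracket of `weilMellin_cutoffCosPoly`; so the dodger's transform on the line is
`(sin bξ/(bξ))·P(ξ²)/Λ_K(ξ²)`. [this track, ATTEMPT-16 Lemma A1] -/
theorem eval_div_prod_eq_one_sub_sum (ν : Fin K → 𝕜) (hν : Function.Injective ν) (hν0 : ∀ k, ν k ≠ 0)
    (P : 𝕜[X]) (hP0 : P.eval 0 = 1) (hdeg : P.natDegree ≤ K) (u : 𝕜) (hu : ∀ k, u ≠ ν k) :
    P.eval u / ∏ k, (1 - u / ν k) =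
      1 - ∑ k, (P.eval (ν k) / ∏ m ∈ univ.erase k, (1 - ν k / ν m)) * (u / (u - ν k)) := by
  classical
  have hΛu : ∏ k, (1 - u / ν k) ≠ 0 := by
    rw [Finset.prod_ne_zero_iff]
    intro k _
    have : u / ν k ≠ 1 := by
      intro h
      rw [div_eq_one_iff_eq (hν0 k)] at h
      exact hu k h
    exact sub_ne_zero.2 (Ne.symm this)
  have hid := eq_nodePoly_add_sum ν hν hν0 P hP0 hdeg
  have hev := congrArg (fun p : 𝕜[X] ↦ p.eval u) hid
  simp only [eval_add, eval_finsetSum, eval_mul, eval_C, eval_X, eval_nodePoly, eval_nodePolyErase] at hev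
  rw [hev, div_eq_iff hΛu, sub_mul, one_mul, Finset.sum_mul, sub_eq_add_neg, ← Finset.sum_neg_distrib]
  congr 1
  refine Finset.sum_congr rfl fun k _ ↦ ?_
  -- Λ^{(k)}(u)/Λ(u) = 1/(1 − u/ν_k)
  have hsplit : ∏ m, (1 - u / ν m) = (1 - u / ν k) * ∏ m ∈ univ.erase k, (1 - u / ν m) :=
    (Finset.mul_prod_erase _ _ (mem_univ k)).symm
  have hfac : (1 - u / ν k) ≠ 0 := by
    have : u / ν k ≠ 1 := by
      intro h; rw [div_eq_one_iff_eq (hν0 k)] at h; exact hu k h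
    exact sub_ne_zero.2 (Ne.symm this)
  have hPe : ∏ m ∈ univ.erase k, (1 - u / ν m) ≠ 0 := by
    rw [Finset.prod_ne_zero_iff]
    intro m _
    have : u / ν m ≠ 1 := by
      intro h; rw [div_eq_one_iff_eq (hν0 m)] at h; exact hu m h
    exact sub_ne_zero.2 (Ne.symm this)
  have hLk : ∏ m ∈ univ.erase k, (1 - ν k / ν m) ≠ 0 := by
    rw [Finset.prod_ne_zero_iff]
    intro m hm
    have hmk : m ≠ k := ne_of_mem_erase hm
    have : ν k / ν m ≠ 1 := by
      intro h; rw [div_eq_one_iff_eq (hν0 m)] at h; exact hmk (hν h).symm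
    exact sub_ne_zero.2 (Ne.symm this)
  have huk : u - ν k ≠ 0 := sub_ne_zero.2 (hu k)
  have hνk : ν k ≠ 0 := hν0 k
  rw [hsplit]
  field_simp
  ring

end Summit.RiemannHypothesis.RiemannHypothesis.Theorems.Handoff
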